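import Literature.AlgebraicTopology.SingularHomology.FundamentalClassProofs
import HarnessLib

/-!
# Existence of the fundamental class (Hatcher Thm. 3.26(a) / Lemma 3.27(a)) — discharge

A. Hatcher, *Algebraic Topology*, CUP 2002, §3.3, Thm. 3.26(a) and Lemma 3.27(a), pp. 236–238:
*if `M` is a closed `R`-oriented `n`-manifold then there is a (unique) class `[M] ∈ Hₙ(M; R)`
whose image in `Hₙ(M | x; R)` is the local orientation `μₓ` for every `x`* — "choose `A = M`" in
Lemma 3.27(a): for compact `A` and a section `x ↦ αₓ` of the orientation covering there is a
unique `α_A ∈ Hₙ(M | A; R)` restricting to every `αₓ`.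

This file DISCHARGES the named fact `Literature.AlgebraicTopology.SingularHomology.existsUnique_isFundamentalClass` of `…FundamentalClass`
(`existsUnique_isFundamentalClass_holds`), for every commutative ring `R`, every `n` and closed
manifolds `X : Type u` in every universe, together with its companions
`Literature.AlgebraicTopology.SingularHomology.HomologicalOrientation.isFundamentalClass_fundamentalClass` (`…_holds`) and
`Literature.AlgebraicTopology.SingularHomology.nonempty_singularHomology_top_iso` (`…_holds`: `Hₙ(X; R) ≅ R` for closed connected oriented
`X`). Uniqueness was already proved in `…FundamentalClassProofs` (`IsFundamentalClass.unique_holds`);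
the new content is **existence**, following the printed proof:

1. **Relative Mayer–Vietoris, gluing** (`clocalHomology.exists_res_eq_and_res_eq`): for closed
   `A`, `B`, classes on `A` and on `B` agreeing on `A ∩ B` glue to a class on `A ∪ B` — exactness of
   `Hₙ(X | A ∪ B) → Hₙ(X | A) ⊕ Hₙ(X | B) → Hₙ(X | A ∩ B)` from the short exact sequence of quotient
   complexes `Subcomplex.mvQuot` (`…ChainSubcomplex`) and the quasi-isomorphism
   `C(X ∖ A) + C(X ∖ B) ↪ C(X ∖ (A ∩ B))` (`isIso_homologyMap_incl_sup_awaySub`, subdivision).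
   (The injectivity half is `clocalHomology.eq_zero_of_res_union` of `…NoncompactManifoldProofs`.)
2. **Comparison of models** (`relativeSingularChainComplex.cmpIso`, `localHomologyOfSet.cmpIso`): a
   *chosen* isomorphism between Mathlib's `Hₙ(X | K; M)` (`Literature.AlgebraicTopology.SingularHomology.localHomologyOfSet`, where
   orientations live) and the concrete `Hₙ(C(X)/C(X ∖ K))` (`Literature.AlgebraicTopology.SingularHomology.clocalHomology`, where Lemma 3.27
   lives), natural under restriction (`cmpIso_hom_comp_res`) and compatible with `c ↦ c|_K`
   (`cmpIso_hom_toLocalOfSet`); from `relativeSingularChainComplex.exists_comparison_iso`.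
3. **Lemma 3.27 for compact subsets in any universe and dimension**
   (`clocalHomology.ptDetermined_of_isCompact_univ`): `ptDetermined_of_isCompact` (spaces in `Type`,
   `n ≥ 1`) transported along `Shrink.homeomorph` (`PtDetermined.of_homeomorph`), and the discrete
   case `n = 0` (`ptDetermined_of_isCompact_of_discrete`).
4. **Induction over a finite cover** (`HomologicalOrientation.IsRepresentedOn`, `.union`,
   `isRepresentedOn_univ`): local consistency of `μ` gives compact neighbourhoods carrying a
   representing class; two representing classes agree on overlaps by uniqueness (3.), so they glue
   (1.); compactness of `X` finishes. The class on `X` of `Hₙ(X | X) ≅ Hₙ(X)` is carried back to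
   Mathlib's `Hₙ(X; R)` by (2.) (`exists_isFundamentalClass`).

Everything is proved (no `sorry`); nothing is asserted.

## References

* A. Hatcher, *Algebraic Topology*, CUP 2002, §3.3, Thm. 3.26, Lemma 3.27, pp. 233–238; §2.2,
  p. 152 (relative Mayer–Vietoris) [HatcherAT2002].
-/

noncomputable section

-- as in `SingularChainsConcrete` / `FundamentalClassProofs`: chains of the concrete complex are
-- `Finsupp`s up to unfolding
set_option backward.isDefEq.respectTransparency false

open CategoryTheory Limits Topology

universe u v w

namespace Literature.AlgebraicTopology.SingularHomology

/-! ### Relative Mayer–Vietoris: gluing of local classes -/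

section Gluing

variable (R : Type v) [CommRing R] (M : Type v) [AddCommGroup M] [Module R M]
variable {X : Type u} [TopologicalSpace X]

namespace clocalHomology

/-- **Relative Mayer–Vietoris, gluing part** (Hatcher 2002, §2.2 p. 152 and proof of
Lemma 3.27 (1), existence: exactness of `Hᵢ(X | A ∪ B) → Hᵢ(X | A) ⊕ Hᵢ(X | B) → Hᵢ(X | A ∩ B)`):
for closed `A`, `B`, two classes `α ∈ Hᵢ(X | A)`, `β ∈ Hᵢ(X | B)` with the same restriction to
`Hᵢ(X | A ∩ B)` are the restrictions of one class `γ ∈ Hᵢ(X | A ∪ B)`. [cite: HatcherAT2002, Lemma 3.27] -/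
theorem exists_res_eq_and_res_eq {A B : Set X} (hA : IsClosed A) (hB : IsClosed B) {i : ℕ}
    (α : clocalHomology R M X A i) (β : clocalHomology R M X B i)
    (h : res R M X (Set.inter_subset_left : A ∩ B ⊆ A) i α =
      res R M X (Set.inter_subset_right : A ∩ B ⊆ B) i β) :
    ∃ γ : clocalHomology R M X (A ∪ B) i,
      res R M X (Set.subset_union_left : A ⊆ A ∪ B) i γ = α ∧
        res R M X (Set.subset_union_right : B ⊆ A ∪ B) i γ = β := by
  set S := awaySub R M X A with hS
  set T := awaySub R M X B with hT
  have hU : S ⊔ T ≤ awaySub R M X (A ∩ B) := sup_awaySub_le R M A B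
  -- notation for the maps on homology
  set Hinl := HomologicalComplex.homologyMap (biprod.inl : S.quotient ⟶ S.quotient ⊞ T.quotient) i
  set Hinr := HomologicalComplex.homologyMap (biprod.inr : T.quotient ⟶ S.quotient ⊞ T.quotient) i
  set Hfst := HomologicalComplex.homologyMap (biprod.fst : S.quotient ⊞ T.quotient ⟶ S.quotient) i
  set Hsnd := HomologicalComplex.homologyMap (biprod.snd : S.quotient ⊞ T.quotient ⟶ T.quotient) i
  set Hf := HomologicalComplex.homologyMap (Subcomplex.mvQuot S T).f i
  set Hg := HomologicalComplex.homologyMap (Subcomplex.mvQuot S T).g i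
  set HqS := HomologicalComplex.homologyMap (Subcomplex.quotientMap (le_sup_left : S ≤ S ⊔ T)) i
  set HqT := HomologicalComplex.homologyMap (Subcomplex.quotientMap (le_sup_right : T ≤ S ⊔ T)) i
  set HqU := HomologicalComplex.homologyMap (Subcomplex.quotientMap hU) i
  -- morphism identities
  have e1 : Hinl ≫ Hg = HqS := by
    rw [← HomologicalComplex.homologyMap_comp, Subcomplex.mvQuot_g, biprod.inl_desc]
  have e2 : Hinr ≫ Hg = -HqT := by
    rw [← HomologicalComplex.homologyMap_comp, Subcomplex.mvQuot_g, biprod.inr_desc,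
      HomologicalComplex.homologyMap_neg]
  have e3 : HqS ≫ HqU = res R M X (Set.inter_subset_left : A ∩ B ⊆ A) i := by
    rw [res_eq, ← HomologicalComplex.homologyMap_comp, Subcomplex.quotientMap_comp_quotientMap]
  have e4 : HqT ≫ HqU = res R M X (Set.inter_subset_right : A ∩ B ⊆ B) i := by
    rw [res_eq, ← HomologicalComplex.homologyMap_comp, Subcomplex.quotientMap_comp_quotientMap]
  have e5 : Hinl ≫ Hfst = 𝟙 _ := by
    rw [← HomologicalComplex.homologyMap_comp, biprod.inl_fst, HomologicalComplex.homologyMap_id]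
  have e6 : Hinr ≫ Hfst = 0 := by
    rw [← HomologicalComplex.homologyMap_comp, biprod.inr_fst, HomologicalComplex.homologyMap_zero]
  have e7 : Hinl ≫ Hsnd = 0 := by
    rw [← HomologicalComplex.homologyMap_comp, biprod.inl_snd, HomologicalComplex.homologyMap_zero]
  have e8 : Hinr ≫ Hsnd = 𝟙 _ := by
    rw [← HomologicalComplex.homologyMap_comp, biprod.inr_snd, HomologicalComplex.homologyMap_id]
  have e9 : Hf ≫ Hfst = HomologicalComplex.homologyMap
      (Subcomplex.quotientMap (inf_le_left : S ⊓ T ≤ S)) i := by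
    rw [← HomologicalComplex.homologyMap_comp, Subcomplex.mvQuot_f, biprod.lift_fst]
  have e10 : Hf ≫ Hsnd = HomologicalComplex.homologyMap
      (Subcomplex.quotientMap (inf_le_right : S ⊓ T ≤ T)) i := by
    rw [← HomologicalComplex.homologyMap_comp, Subcomplex.mvQuot_f, biprod.lift_snd]
  -- the element `(α, β)` of `Hᵢ(K/S ⊞ K/T)` maps to zero in `Hᵢ(K/(S ⊔ T)) ≅ Hᵢ(X | A ∩ B)`
  set y : (S.quotient ⊞ T.quotient).homology i := Hinl α + Hinr β with hy
  have hgy : Hg y = HqS α - HqT β := by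
    rw [hy, map_add]
    change (Hinl ≫ Hg) α + (Hinr ≫ Hg) β = _
    rw [e1, e2, sub_eq_add_neg]
    rfl
  have hg : Hg y = 0 := by
    haveI := Subcomplex.isIso_homologyMap_quotientMap hU
      (isIso_homologyMap_incl_sup_awaySub R M hA hB) i
    apply (ModuleCat.mono_iff_injective HqU).1 inferInstance
    rw [map_zero, hgy, map_sub]
    change (HqS ≫ HqU) α - (HqT ≫ HqU) β = 0
    rw [e3, e4, h, sub_self]
  -- exactness gives a preimage in `Hᵢ(K/(S ⊓ T)) = Hᵢ(X | A ∪ B)`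
  obtain ⟨x, hx⟩ := (ShortComplex.moduleCat_exact_iff _).1
    ((Subcomplex.mvQuot_shortExact S T).homology_exact₂ i) y hg
  change Hf x = y at hx
  have hfst : Hfst y = α := by
    rw [hy, map_add]
    change (Hinl ≫ Hfst) α + (Hinr ≫ Hfst) β = α
    rw [e5, e6]
    simp
  have hsnd : Hsnd y = β := by
    rw [hy, map_add]
    change (Hinl ≫ Hsnd) α + (Hinr ≫ Hsnd) β = β
    rw [e7, e8]
    simp
  have hge : S ⊓ T ≤ awaySub R M X (A ∪ B) := (awaySub_union R M A B).ge
  refine ⟨HomologicalComplex.homologyMap (Subcomplex.quotientMap hge) i x, ?_, ?_⟩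
  · have e : HomologicalComplex.homologyMap (Subcomplex.quotientMap hge) i ≫
        res R M X (Set.subset_union_left : A ⊆ A ∪ B) i = Hf ≫ Hfst := by
      rw [e9, res_eq, ← HomologicalComplex.homologyMap_comp, Subcomplex.quotientMap_comp_quotientMap]
    change (HomologicalComplex.homologyMap (Subcomplex.quotientMap hge) i ≫ res R M X _ i) x = α
    rw [e]
    change Hfst (Hf x) = α
    rw [hx, hfst]
  · have e : HomologicalComplex.homologyMap (Subcomplex.quotientMap hge) i ≫
        res R M X (Set.subset_union_right : B ⊆ A ∪ B) i = Hf ≫ Hsnd := by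
      rw [e10, res_eq, ← HomologicalComplex.homologyMap_comp, Subcomplex.quotientMap_comp_quotientMap]
    change (HomologicalComplex.homologyMap (Subcomplex.quotientMap hge) i ≫ res R M X _ i) x = β
    rw [e]
    change Hsnd (Hf x) = β
    rw [hx, hsnd]

end clocalHomology

end Gluing

/-! ### A chosen comparison `Hₙ(X | K)` (Mathlib model) `≅ Hₙ(X | K)` (concrete), natural in `K` -/

section Comparison

variable (R : Type v) [CommRing R] (M : Type v) [AddCommGroup M] [Module R M]
variable {X : Type u} [TopologicalSpace X]

/-- A chosen comparison isomorphism of the two models of relative chains,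
`C_•(X, A) ≅ C(X)/C(A)` (`relativeSingularChainComplex.exists_comparison_iso`). [folklore] -/
def relativeSingularChainComplex.cmpIso (A : Set X) :
    relativeSingularChainComplex R M X A ≅ (chainsInSub R M X A).quotient :=
  (relativeSingularChainComplex.exists_comparison_iso R M (X := X) A).choose

/-- The chosen comparison is compatible with the projections from `C_•(X) ≅ C(X)`. [folklore] -/
@[reassoc]
lemma relativeSingularChainComplex.π_comp_cmpIso_hom (A : Set X) :
    relativeSingularChainComplex.π R M X A ≫ (relativeSingularChainComplex.cmpIso R M A).hom =
      (csingularChainComplex.compIso R M X).inv ≫ (chainsInSub R M X A).π :=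
  (relativeSingularChainComplex.exists_comparison_iso R M (X := X) A).choose_spec

/-- Naturality of the chosen comparison under enlarging the subspace, `A ⊆ B`: the map of pairs
`(X, A) → (X, B)` corresponds to the quotient map `C(X)/C(A) → C(X)/C(B)`. [folklore] -/
lemma relativeSingularChainComplex.cmpIso_hom_comp_quotientMap {A B : Set X} (h : A ⊆ B) :
    (relativeSingularChainComplex.cmpIso R M A).hom ≫
        Subcomplex.quotientMap (chainsInSub_mono R M h) =
      relativeSingularChainComplex.map R M (ContinuousMap.id X) (fun _ hx => h hx) ≫
        (relativeSingularChainComplex.cmpIso R M B).hom := by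
  haveI := relativeSingularChainComplex.epi_π R M (X := X) A
  rw [← cancel_epi (relativeSingularChainComplex.π R M X A),
    relativeSingularChainComplex.π_comp_cmpIso_hom_assoc, Subcomplex.π_quotientMap,
    relativeSingularChainComplex.π_comp_map_assoc, singularChainComplex.map_id, Category.id_comp,
    relativeSingularChainComplex.π_comp_cmpIso_hom]

variable (X) in
/-- The chosen comparison on local homology, `Hₙ(X | K; M)` in Mathlib's model `≅ Hₙ(X | K; M)` in
the concrete model. [folklore] -/
def localHomologyOfSet.cmpIso (K : Set X) (n : ℕ) :
    localHomologyOfSet R M X K n ≅ clocalHomology R M X K n :=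
  (HomologicalComplex.homologyFunctor _ _ n).mapIso (relativeSingularChainComplex.cmpIso R M Kᶜ)

/-- The comparison commutes with restriction `Hₙ(X | K) → Hₙ(X | L)`, `L ⊆ K`. [folklore] -/
@[reassoc]
lemma localHomologyOfSet.cmpIso_hom_comp_res {K L : Set X} (h : L ⊆ K) (n : ℕ) :
    (localHomologyOfSet.cmpIso R M X K n).hom ≫ clocalHomology.res R M X h n =
      restrictLocal R M h n ≫ (localHomologyOfSet.cmpIso R M X L n).hom := by
  change HomologicalComplex.homologyMap _ n ≫ _ = HomologicalComplex.homologyMap _ n ≫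
    HomologicalComplex.homologyMap _ n
  rw [clocalHomology.res_eq, ← HomologicalComplex.homologyMap_comp,
    ← HomologicalComplex.homologyMap_comp,
    relativeSingularChainComplex.cmpIso_hom_comp_quotientMap R M (Set.compl_subset_compl.2 h)]

/-- The comparison applied to `c|_K`: for `c ∈ Hₙ(X; M)`,
`cmp (c|_K) = [c̃] ∈ Hₙ(C(X)/C(X ∖ K))` where `c̃` is the concrete class of `c`. [folklore] -/
lemma localHomologyOfSet.cmpIso_hom_toLocalOfSet (K : Set X) (n : ℕ) (c : singularHomology R M X n) :
    (localHomologyOfSet.cmpIso R M X K n).hom (singularHomology.toLocalOfSet R M X K n c) =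
      HomologicalComplex.homologyMap (awaySub R M X K).π n
        ((csingularHomology.compIso R M X n).inv c) := by
  change (HomologicalComplex.homologyMap (relativeSingularChainComplex.π R M X Kᶜ) n ≫
      HomologicalComplex.homologyMap (relativeSingularChainComplex.cmpIso R M Kᶜ).hom n) c =
    (HomologicalComplex.homologyMap (csingularChainComplex.compIso R M X).inv n ≫
      HomologicalComplex.homologyMap (awaySub R M X K).π n) c
  rw [← HomologicalComplex.homologyMap_comp, ← HomologicalComplex.homologyMap_comp,
    relativeSingularChainComplex.π_comp_cmpIso_hom]

end Comparison

/-! ### Lemma 3.27 for compact subsets of manifolds in any universe and every dimension -/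

section Compact

variable (R : Type v) [CommRing R] (M : Type v) [AddCommGroup M] [Module R M]
variable {X : Type u} [TopologicalSpace X]

namespace clocalHomology

/-- `P(K)` for a compact subset `K` of a discrete space (a `0`-manifold), every `n`: `K` is finite, a
finite union of points (Hatcher 2002, Lemma 3.27 in dimension `0`). [folklore] -/
theorem ptDetermined_of_isCompact_of_discrete [DiscreteTopology X] (n : ℕ) {K : Set X}
    (hK : IsCompact K) : PtDetermined R M X n K := by
  have hKf : K.Finite := hK.finite_of_discrete
  have heq : K = ⋃ x ∈ hKf.toFinset, ({x} : Set X) := by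
    ext y
    simp
  rw [heq]
  refine ptDetermined_biUnion R M (Q := fun A : Set X => A.Subsingleton)
    (fun A B hA _ => hA.anti Set.inter_subset_left) (fun A _ => isClosed_discrete A)
    (fun A hA => ?_) hKf.toFinset (fun x => ({x} : Set X)) fun x _ => Set.subsingleton_singleton
  rcases hA.eq_empty_or_singleton with rfl | ⟨x, rfl⟩
  · exact ptDetermined_empty R M n
  · exact ptDetermined_singleton_of_discrete R M n x

/-- **Lemma 3.27 for compact subsets of closed manifolds, any universe and every dimension**
(Hatcher 2002, Lemma 3.27, part (b) and the uniqueness half of (a)): for a compact subset `K` of a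
closed topological `n`-manifold `X : Type u`, `Hᵢ(X | K; M) = 0` for `i > n`, and a class of
`Hₙ(X | K; M)` vanishing in every `Hₙ(X | x; M)`, `x ∈ K`, is zero. For `n ≥ 1` this is
`ptDetermined_of_isCompact` (spaces in `Type`) transported along `Shrink.homeomorph` (a compact
manifold is small; `PtDetermined.of_homeomorph`); for `n = 0` the manifold is discrete.
[cite: HatcherAT2002, Lemma 3.27] -/
theorem ptDetermined_of_isCompact_univ {n : ℕ} [CompactSpace X] [T2Space X]
    [ChartedSpace (EuclideanSpace ℝ (Fin n)) X] {K : Set X} (hK : IsCompact K) :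
    PtDetermined R M X n K := by
  rcases Nat.eq_zero_or_pos n with rfl | hn
  · haveI : DiscreteTopology X := by
      refine discreteTopology_iff_isOpen_singleton.mpr fun z => ?_
      have hsub : (chartAt (EuclideanSpace ℝ (Fin 0)) z).source ⊆ {z} := fun y hy =>
        (chartAt (EuclideanSpace ℝ (Fin 0)) z).injOn hy (mem_chart_source _ z)
          (Subsingleton.elim _ _)
      have heq : (chartAt (EuclideanSpace ℝ (Fin 0)) z).source = {z} :=
        hsub.antisymm (Set.singleton_subset_iff.mpr (mem_chart_source _ z))
      exact heq ▸ (chartAt (EuclideanSpace ℝ (Fin 0)) z).open_source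
    exact ptDetermined_of_isCompact_of_discrete R M 0 hK
  · haveI : Small.{0} X := small_of_compactSpace_chartedSpace (EuclideanSpace ℝ (Fin n))
    let φ : X ≃ₜ Shrink.{0} X := Shrink.homeomorph X
    haveI : T2Space (Shrink.{0} X) := φ.t2Space
    letI : ChartedSpace X (Shrink.{0} X) := φ.symm.toOpenPartialHomeomorph.singletonChartedSpace rfl
    letI : ChartedSpace (EuclideanSpace ℝ (Fin n)) (Shrink.{0} X) :=
      ChartedSpace.comp (EuclideanSpace ℝ (Fin n)) X (Shrink.{0} X)
    have hY : PtDetermined R M (Shrink.{0} X) n (φ '' K) :=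
      ptDetermined_of_isCompact R M hn (hK.image φ.continuous)
    exact hY.of_homeomorph R M φ (Set.preimage_image_eq K φ.injective)

end clocalHomology

end Compact

/-! ### Existence of the fundamental class -/

section Existence

variable {R : Type v} [CommRing R]
variable {X : Type u} [TopologicalSpace X] {n : ℕ}

namespace HomologicalOrientation

/-- The local orientation `μₓ` read in the concrete model `Hₙ(C(X)/C(X ∖ x))` through the chosen
comparison. [folklore] -/
abbrev clocalClass (μ : HomologicalOrientation R X n) (x : X) : clocalHomology R R X {x} n :=
  (localHomologyOfSet.cmpIso R R X {x} n).hom (μ.localClass x)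

/-- `μ` is *represented on* `K` if one class of the concrete `Hₙ(X | K; R)` restricts to `μₓ` at
every `x ∈ K` — the class `α_K` of Hatcher 2002, Lemma 3.27(a), for the section `x ↦ μₓ`.
[cite: HatcherAT2002, Lemma 3.27] -/
def IsRepresentedOn (μ : HomologicalOrientation R X n) (K : Set X) : Prop :=
  ∃ α : clocalHomology R R X K n, ∀ (x : X) (hx : x ∈ K),
    clocalHomology.res R R X (Set.singleton_subset_iff.2 hx) n α = μ.clocalClass x

/-- `μ` is represented on the empty set (by `0`). [folklore] -/
lemma isRepresentedOn_empty (μ : HomologicalOrientation R X n) : μ.IsRepresentedOn (∅ : Set X) :=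
  ⟨0, fun _ hx => hx.elim⟩

/-- **Local consistency gives local representing classes**: every point has a compact neighbourhood
on which `μ` is represented (Hatcher 2002, §3.3, p. 235: the classes `μ_B` on balls; here read in
the concrete model through the comparison). [cite: HatcherAT2002, §3.3 p. 235] -/
lemma exists_isCompact_mem_nhds_isRepresentedOn [LocallyCompactSpace X]
    (μ : HomologicalOrientation R X n) (x : X) :
    ∃ K : Set X, IsCompact K ∧ K ∈ 𝓝 x ∧ μ.IsRepresentedOn K := by
  obtain ⟨K, hK, μK, hμK⟩ := μ.locallyConsistent x
  obtain ⟨K', hK'x, hK'K, hK'c⟩ := local_compact_nhds hK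
  refine ⟨K', hK'c, hK'x, (localHomologyOfSet.cmpIso R R X K' n).hom (restrictLocal R R hK'K n μK),
    fun y hy => ?_⟩
  change ((localHomologyOfSet.cmpIso R R X K' n).hom ≫ clocalHomology.res R R X _ n) _ = _
  rw [localHomologyOfSet.cmpIso_hom_comp_res]
  change (localHomologyOfSet.cmpIso R R X {y} n).hom
    (restrictToPoint R R hy n (restrictLocal R R hK'K n μK)) = _
  rw [restrictToPoint_restrictLocal_apply, hμK y (hK'K hy)]

/-- **Lemma 3.27(a), existence, step (1): gluing over a union.** If `μ` is represented on the
compact sets `A` and `B` of the Hausdorff space `X`, and `P(A ∩ B)` holds (uniqueness on the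
overlap), then `μ` is represented on `A ∪ B` (relative Mayer–Vietoris,
`clocalHomology.exists_res_eq_and_res_eq`). [cite: HatcherAT2002, Lemma 3.27] -/
lemma IsRepresentedOn.union [T2Space X] {μ : HomologicalOrientation R X n} {A B : Set X}
    (hA : IsCompact A) (hB : IsCompact B) (hPA : clocalHomology.PtDetermined R R X n (A ∩ B))
    (hμA : μ.IsRepresentedOn A) (hμB : μ.IsRepresentedOn B) : μ.IsRepresentedOn (A ∪ B) := by
  obtain ⟨α, hα⟩ := hμA
  obtain ⟨β, hβ⟩ := hμB
  -- the two classes agree on `A ∩ B`, by uniqueness there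
  have hagree : clocalHomology.res R R X (Set.inter_subset_left : A ∩ B ⊆ A) n α =
      clocalHomology.res R R X (Set.inter_subset_right : A ∩ B ⊆ B) n β := by
    rw [← sub_eq_zero]
    refine hPA.2 _ fun x hx => ?_
    rw [map_sub, sub_eq_zero]
    change (clocalHomology.res R R X _ n ≫ clocalHomology.res R R X _ n) α =
      (clocalHomology.res R R X _ n ≫ clocalHomology.res R R X _ n) β
    rw [clocalHomology.res_comp_res, clocalHomology.res_comp_res, hα x hx.1, hβ x hx.2]
  obtain ⟨γ, hγA, hγB⟩ :=
    clocalHomology.exists_res_eq_and_res_eq R R hA.isClosed hB.isClosed α β hagree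
  refine ⟨γ, fun x hx => ?_⟩
  rcases hx with hxA | hxB
  · rw [← hα x hxA, ← hγA]
    change _ = (clocalHomology.res R R X _ n ≫ clocalHomology.res R R X _ n) γ
    rw [clocalHomology.res_comp_res]
  · rw [← hβ x hxB, ← hγB]
    change _ = (clocalHomology.res R R X _ n ≫ clocalHomology.res R R X _ n) γ
    rw [clocalHomology.res_comp_res]

/-- **Lemma 3.27(a), existence, for `A = M` compact**: on a closed topological `n`-manifold every
`R`-orientation is represented on the whole space by a class of the concrete `Hₙ(X | X; R)`
(induction over a finite cover by compact neighbourhoods carrying local classes, Hatcher 2002,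
Lemma 3.27, steps (1)–(2)). [cite: HatcherAT2002, Lemma 3.27] -/
theorem isRepresentedOn_univ [CompactSpace X] [T2Space X]
    [ChartedSpace (EuclideanSpace ℝ (Fin n)) X] (μ : HomologicalOrientation R X n) :
    μ.IsRepresentedOn (Set.univ : Set X) := by
  haveI : LocallyCompactSpace X := ChartedSpace.locallyCompactSpace (EuclideanSpace ℝ (Fin n)) X
  choose K hKc hKx hKμ using μ.exists_isCompact_mem_nhds_isRepresentedOn
  obtain ⟨t, ht⟩ := isCompact_univ.elim_finite_subcover (fun x => interior (K x))
    (fun _ => isOpen_interior) fun x _ => Set.mem_iUnion.2 ⟨x, mem_interior_iff_mem_nhds.2 (hKx x)⟩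
  -- induction over the finite cover
  have key : ∀ s : Finset X, IsCompact (⋃ x ∈ s, K x) ∧ μ.IsRepresentedOn (⋃ x ∈ s, K x) := by
    classical
    intro s
    induction s using Finset.induction_on with
    | empty =>
      simp only [Finset.notMem_empty, Set.iUnion_of_empty, Set.iUnion_empty]
      exact ⟨isCompact_empty, μ.isRepresentedOn_empty⟩
    | @insert a s ha ih =>
      rw [Finset.set_biUnion_insert]
      exact ⟨(hKc a).union ih.1, IsRepresentedOn.union (hKc a) ih.1
        (clocalHomology.ptDetermined_of_isCompact_univ R R ((hKc a).inter_right ih.1.isClosed))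
        (hKμ a) ih.2⟩
  have huniv : (⋃ x ∈ t, K x) = Set.univ :=
    Set.eq_univ_of_univ_subset (ht.trans (Set.iUnion₂_mono fun x _ => interior_subset))
  rw [← huniv]
  exact (key t).2

end HomologicalOrientation

/-- **Existence of the fundamental class** (Hatcher 2002, §3.3, Thm. 3.26(a), via Lemma 3.27(a)
with `A = M`): on a closed `R`-oriented topological `n`-manifold `X : Type u` there is a class
`c ∈ Hₙ(X; R)` restricting to the local orientation `μₓ` at every point. The representing class on
`X` of the concrete `Hₙ(X | X; R) ≅ Hₙ(X; R)` is carried to Mathlib's `Hₙ(X; R)` by the comparison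
isomorphisms. [cite: HatcherAT2002, Thm. 3.26(a)] -/
theorem exists_isFundamentalClass [CompactSpace X] [T2Space X]
    [ChartedSpace (EuclideanSpace ℝ (Fin n)) X] (μ : HomologicalOrientation R X n) :
    ∃ c : singularHomology R R X n, IsFundamentalClass μ c := by
  obtain ⟨α, hα⟩ := μ.isRepresentedOn_univ
  haveI := isIso_π_awaySub_univ R R (X := X)
  haveI : IsIso (HomologicalComplex.homologyMap (awaySub R R X Set.univ).π n) := inferInstance
  set z : csingularHomology R R X n :=
    inv (HomologicalComplex.homologyMap (awaySub R R X Set.univ).π n) α with hz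
  have hzα : HomologicalComplex.homologyMap (awaySub R R X Set.univ).π n z = α := by
    rw [hz, ← ModuleCat.comp_apply, IsIso.inv_hom_id, ModuleCat.id_apply]
  refine ⟨(csingularHomology.compIso R R X n).hom z, fun x => ?_⟩
  apply (localHomologyOfSet.cmpIso R R X {x} n).toLinearEquiv.injective
  change (localHomologyOfSet.cmpIso R R X {x} n).hom
    (singularHomology.toLocalOfSet R R X {x} n ((csingularHomology.compIso R R X n).hom z)) =
      μ.clocalClass x
  rw [localHomologyOfSet.cmpIso_hom_toLocalOfSet, ← hα x (Set.mem_univ x), clocalHomology.res_eq,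
    ← hzα]
  change (((csingularHomology.compIso R R X n).hom ≫ (csingularHomology.compIso R R X n).inv) ≫
      HomologicalComplex.homologyMap (awaySub R R X {x}).π n) z =
    (HomologicalComplex.homologyMap (awaySub R R X Set.univ).π n ≫
      HomologicalComplex.homologyMap (Subcomplex.quotientMap _) n) z
  rw [Iso.hom_inv_id, Category.id_comp, ← HomologicalComplex.homologyMap_comp,
    Subcomplex.π_quotientMap]

/-- **Hatcher Thm. 3.26(a) — discharge of the named fact `existsUnique_isFundamentalClass`**: a
closed `R`-oriented topological `n`-manifold `X : Type u` (any universe, any `n`, any commutative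
ring `R`) has a unique fundamental class (existence: `exists_isFundamentalClass`; uniqueness:
`IsFundamentalClass.unique_holds`, Lemma 3.27(a) with `A = M`). [cite: HatcherAT2002, Thm. 3.26(a)] -/
theorem existsUnique_isFundamentalClass_holds (n : ℕ) :
    existsUnique_isFundamentalClass (R := R) (X := X) (n := n) := by
  intro _ _ _ μ
  obtain ⟨c, hc⟩ := exists_isFundamentalClass μ
  exact ⟨c, hc, fun c' hc' => IsFundamentalClass.unique_holds R X n hc' hc⟩

namespace HomologicalOrientation

/-- **Discharge of `isFundamentalClass_fundamentalClass`**: on a closed `R`-oriented manifold,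
`μ.fundamentalClass` is a fundamental class (Hatcher 2002, Thm. 3.26(a)). [cite: HatcherAT2002, Thm. 3.26(a)] -/
theorem isFundamentalClass_fundamentalClass_holds (n : ℕ) :
    isFundamentalClass_fundamentalClass (R := R) (X := X) (n := n) := by
  intro _ _ _ μ
  exact isFundamentalClass_fundamentalClass_of_exists (exists_isFundamentalClass μ)

end HomologicalOrientation

/-- **`Hₙ(X; R) → Hₙ(X | x; R)` is an isomorphism on a closed connected `R`-oriented manifold**
(Hatcher 2002, Thm. 3.26(a): "the map `Hₙ(M; R) → Hₙ(M | x; R) ≅ R` is an isomorphism for all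
`x`"): injective by Thm. 3.26(b) (`toLocal_injective_of_connectedSpace_holds`), and the fundamental
class (`exists_isFundamentalClass`) hits the generator `μₓ`. [cite: HatcherAT2002, Thm. 3.26(a)] -/
theorem singularHomology.isIso_toLocal_of_orientation [CompactSpace X] [T2Space X]
    [ChartedSpace (EuclideanSpace ℝ (Fin n)) X] [ConnectedSpace X] (μ : HomologicalOrientation R X n)
    (x : X) : IsIso (singularHomology.toLocal R R x n) := by
  obtain ⟨c, hc⟩ := exists_isFundamentalClass μ
  refine (ConcreteCategory.isIso_iff_bijective _).2 ⟨?_, fun y => ?_⟩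
  · exact singularHomology.toLocal_injective_of_connectedSpace_holds R R X n x
  · obtain ⟨e, he⟩ := μ.isGenerator x
    refine ⟨e y • c, ?_⟩
    change singularHomology.toLocal R R x n (e y • c) = y
    rw [map_smul, hc x]
    apply e.injective
    rw [map_smul, he, smul_eq_mul, mul_one]

/-- **Hatcher Thm. 3.26(a), `Hₙ(X; R) ≅ R` — discharge of the named fact
`nonempty_singularHomology_top_iso`**: for a closed connected `R`-oriented topological `n`-manifold,
`Hₙ(X; R) ≅ Hₙ(X | x; R) ≅ R`. [cite: HatcherAT2002, Thm. 3.26(a)] -/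
theorem nonempty_singularHomology_top_iso_holds (n : ℕ) :
    nonempty_singularHomology_top_iso (R := R) (X := X) (n := n) := by
  intro _ _ _ _ μ
  obtain ⟨x⟩ := (inferInstance : Nonempty X)
  haveI := singularHomology.isIso_toLocal_of_orientation μ x
  obtain ⟨e, -⟩ := μ.isGenerator x
  exact ⟨asIso (singularHomology.toLocal R R x n) ≪≫
    (e.trans (ULift.moduleEquiv.{_, _, u}).symm).toModuleIso⟩

end Existence

end Literature.AlgebraicTopology.SingularHomology

end
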